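import Literature.LinearAlgebra.FreeModule.AlternatingElementaryDivisorsUnique
import HarnessLib

/-!
# The discriminant group of a symplectic lattice of type `d`: `M*/E(M) ≅ (∏ᵢ ℤ/dᵢ)²` ([Lange 2023] §1.5.1; [Adkins–Weintraub] 6.2.35)

Topic `Literature/LinearAlgebra/FreeModule`; namespace `Literature.LinearAlgebra.FreeModule`.
For an alternating integral bilinear form `E` on a free `ℤ`-module `M` with a Frobenius (symplectic) basis `b` of type
`d = (d₁, …, d_g)` (★ `IsFrobeniusBasis`), the cokernel of `E : M → M* = Hom(M, ℤ)`, `x ↦ E(x, ·)` — the quotient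
`Λ(L)/Λ ≅ K(L)` of the theory of abelian varieties, «`M*/Im(α_φ)`» of [AdkinsWeintraub1992] — is isomorphic to
`(∏ᵢ ℤ/dᵢ) × (∏ᵢ ℤ/dᵢ)`: in the dual basis `E(λᵢ) = dᵢ·μᵢ*`, `E(μᵢ) = −dᵢ·λᵢ*`.  With all `dᵢ > 0` its order is
`(∏ dᵢ)²`.  THEOREMS ONLY (no definition, no named fact, no instance, no `sorry`).  Cell hodgecm-mathlib (D-0151),
U-DAG brick B4 flag (1) third (β) (B-plan1 R53): the lattice side of «`pol.HasType δ` ↔ analytic type».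
HC_CM is proved only modulo the printed citations until rung 0 closes.

## References
* [Lange2023AbelianVarietiesComplex] H. Lange, *Abelian Varieties over the Complex Numbers* (2023), §1.5.1 (the type of a
  line bundle; `K(L) = Λ(L)/Λ ≅ (⊕ ℤ/dᵢℤ)²`).
* [AdkinsWeintraub1992] W. Adkins, S. Weintraub, *Algebra: An Approach via Module Theory* (1992), Ch. 6 Thm. 2.35 (p. 361).
* [LangeBirkenhake1992] H. Lange, Ch. Birkenhake, *Complex Abelian Varieties* (1992), §3.1 (Lemma 3.1.4 context).
-/

set_option autoImplicit false

open Module Submodule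

namespace Literature.LinearAlgebra.FreeModule

namespace IsFrobeniusBasis

variable {M : Type*} [AddCommGroup M] {E : LinearMap.BilinForm ℤ M} {g : ℕ} {b : Basis (Fin g ⊕ Fin g) ℤ M}
  {d : Fin g → ℕ}

/-- **The image of `E : M → M*` in dual-basis coordinates** is `⊕ₖ d_{ι(k)}ℤ` (`ι(inl i) = ι(inr i) = i`):
`E(λᵢ) = dᵢ μᵢ*`, `E(μᵢ) = −dᵢ λᵢ*`. [cite: AdkinsWeintraub1992, Ch. 6 Thm. 2.35 (p. 361), proof]
[cite: Lange2023AbelianVarietiesComplex, §1.5.1] -/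
theorem map_equivFun_range_eq_pi (h : IsFrobeniusBasis E b d) (hA : E.IsAlt) :
    Submodule.map (b.dualBasis.equivFun : Module.Dual ℤ M →ₗ[ℤ] (Fin g ⊕ Fin g → ℤ)) (LinearMap.range E) =
      Submodule.pi Set.univ (fun k => Ideal.span {(d (Sum.elim id id k) : ℤ)}) := by
  classical
  ext f
  simp only [Submodule.mem_map, LinearMap.mem_range, Submodule.mem_pi, Set.mem_univ, true_implies]
  constructor
  · rintro ⟨l, ⟨x, rfl⟩, rfl⟩ k
    rw [LinearEquiv.coe_coe, Basis.equivFun_apply, Basis.dualBasis_repr, Ideal.mem_span_singleton']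
    rcases k with j | j
    · exact ⟨-(b.repr x (Sum.inr j)), by rw [h.apply_inl hA]; simp [Sum.elim_inl]⟩
    · exact ⟨b.repr x (Sum.inl j), by rw [h.apply_inr]; simp [Sum.elim_inr]⟩
  · intro hf
    have hc : ∀ k, ∃ c : ℤ, c * (d (Sum.elim id id k) : ℤ) = f k := fun k => Ideal.mem_span_singleton'.1 (hf k)
    choose c hc using hc
    -- the preimage `x = ∑ⱼ c(μⱼ) λⱼ − ∑ⱼ c(λⱼ) μⱼ`
    set a : Fin g ⊕ Fin g → ℤ := Sum.elim (fun j => c (Sum.inr j)) (fun j => -c (Sum.inl j)) with ha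
    refine ⟨E (b.equivFun.symm a), ⟨b.equivFun.symm a, rfl⟩, ?_⟩
    have hrepr : ∀ k, b.repr (b.equivFun.symm a) k = a k := fun k => by
      rw [← Basis.equivFun_apply, LinearEquiv.apply_symm_apply]
    funext k
    rw [LinearEquiv.coe_coe, Basis.equivFun_apply, Basis.dualBasis_repr]
    rcases k with j | j
    · rw [h.apply_inl hA, hrepr, ← hc (Sum.inl j), ha]
      simp [Sum.elim_inr, Sum.elim_inl]
    · rw [h.apply_inr, hrepr, ← hc (Sum.inr j), ha]
      simp [Sum.elim_inl, Sum.elim_inr]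

/-- **`M*/E(M) ≅ (∏ᵢ ℤ/dᵢ) × (∏ᵢ ℤ/dᵢ)`** for a Frobenius basis of type `d` of the alternating form `E` — the discriminant
group `Λ(L)/Λ = K(L) ≅ (ℤ/d₁ × ⋯ × ℤ/d_g)²` of [Lange2023AbelianVarietiesComplex, §1.5.1], «`M*/Im(α_φ)` has invariant
factors `e₁, e₁, …, e_k, e_k`» of [AdkinsWeintraub1992, Ch. 6 Thm. 2.35].
[cite: Lange2023AbelianVarietiesComplex, §1.5.1] [cite: AdkinsWeintraub1992, Ch. 6 Thm. 2.35 (p. 361)] -/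
theorem nonempty_dualQuotRange_addEquiv (h : IsFrobeniusBasis E b d) (hA : E.IsAlt) :
    Nonempty ((Module.Dual ℤ M ⧸ LinearMap.range E) ≃+ (((i : Fin g) → ZMod (d i)) × ((i : Fin g) → ZMod (d i)))) := by
  classical
  -- (1) dual-basis coordinates `M* ≃ ℤ^{2g}` carry `E(M)` to `⊕ₖ d_{ι(k)} ℤ`
  set ψ : Module.Dual ℤ M ≃ₗ[ℤ] (Fin g ⊕ Fin g → ℤ) := b.dualBasis.equivFun with hψ
  set p : Fin g ⊕ Fin g → Submodule ℤ ℤ := fun k => Ideal.span {(d (Sum.elim id id k) : ℤ)} with hp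
  have hmap : Submodule.map (ψ : Module.Dual ℤ M →ₗ[ℤ] (Fin g ⊕ Fin g → ℤ)) (LinearMap.range E) = Submodule.pi Set.univ p :=
    h.map_equivFun_range_eq_pi hA
  -- (2) quotient of a product = product of quotients; `ℤ/dℤ = ZMod d`
  let e₁ : (Module.Dual ℤ M ⧸ LinearMap.range E) ≃ₗ[ℤ] ((Fin g ⊕ Fin g → ℤ) ⧸ Submodule.pi Set.univ p) :=
    Submodule.Quotient.equiv (LinearMap.range E) (Submodule.pi Set.univ p) ψ hmap
  let e₂ : ((Fin g ⊕ Fin g → ℤ) ⧸ Submodule.pi Set.univ p) ≃ₗ[ℤ] ((k : Fin g ⊕ Fin g) → ℤ ⧸ p k) :=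
    Submodule.quotientPi p
  let e₃ : ((k : Fin g ⊕ Fin g) → ℤ ⧸ p k) ≃+ ((k : Fin g ⊕ Fin g) → ZMod (d (Sum.elim id id k))) :=
    AddEquiv.piCongrRight fun k => (Int.quotientSpanNatEquivZMod (d (Sum.elim id id k))).toAddEquiv
  let e₄ : ((k : Fin g ⊕ Fin g) → ZMod (d (Sum.elim id id k))) ≃+
      (((i : Fin g) → ZMod (d i)) × ((i : Fin g) → ZMod (d i))) :=
    { Equiv.sumPiEquivProdPi (fun k => ZMod (d (Sum.elim id id k))) with
      map_add' := fun x y => rfl }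
  exact ⟨e₁.toAddEquiv.trans (e₂.toAddEquiv.trans (e₃.trans e₄))⟩

/-- **Order of the discriminant group**: `#(M*/E(M)) = (∏ᵢ dᵢ)²` for a Frobenius basis of type `d` (as natural
cardinalities: both sides vanish when some `dᵢ = 0`, `ℤ/0 = ℤ` being infinite).
[cite: Lange2023AbelianVarietiesComplex, §1.5.1] [cite: AdkinsWeintraub1992, Ch. 6 Thm. 2.35 (p. 361)] -/
theorem natCard_dualQuotRange (h : IsFrobeniusBasis E b d) (hA : E.IsAlt) :
    Nat.card (Module.Dual ℤ M ⧸ LinearMap.range E) = (∏ i, d i) ^ 2 := by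
  classical
  obtain ⟨e⟩ := h.nonempty_dualQuotRange_addEquiv hA
  rw [Nat.card_congr e.toEquiv, Nat.card_prod, Nat.card_pi, sq]
  simp only [Nat.card_zmod]

end IsFrobeniusBasis

end Literature.LinearAlgebra.FreeModule
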